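import Summits.HodgeConjecture.HodgeConjecture.Theorems.Ring2HypothesesDescentMotivatedPositivity
import Summits.HodgeConjecture.HodgeConjecture.Theorems.Ring2HypothesesDescentMotivatedSemisimple
import Summits.HodgeConjecture.HodgeConjecture.Theorems.Ring2HypothesesDescentMotivatedStarOperator
import Summits.HodgeConjecture.HodgeConjecture.Theorems.Ring2HypothesesDescentMotivatedTranspose
import Summits.HodgeConjecture.HodgeConjecture.Theorems.MotivatedLefschetzSplitLefschetzStandardBPolarizationOperator
import Literature.AlgebraicGeometry.HodgeTheory.HodgeSectionRestrictionPairing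
import Mathlib.RingTheory.Artinian.Module
import HarnessLib

/-!
# Ring 2 hypotheses, descent face — the motivated operator algebra `R_a = C⁰_mot(X, X)_ℂ|_{Hᵃ}` is STABLE under
# André's positive involution `T ↦ T'` (the conjugate `Q_D`-adjoint): `(R_a, ')` is a positive involutive algebra,
# whence André's own proof of its semisimplicity — on the real carriers, degrees `a ≤ dim X`, unconditionally

research route conditional on HC_CM; not a corollary; Q11.4-sentence-2 already refuted in dim ≥ 3.
Cell `pub-hodge-ring2` (Hodge ladder STAGE 3), seat `ring2-b05` (binder row b05
`Ring2.Hypotheses.MotivatedImpliesAlgebraicAV`), gen 39, part 3 (parts 1–2: `…MotivatedWeilForm`, `…MotivatedPositivity`).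
`HC_CM` (`Theses.RankFourFaces.CMAbelianHodge`) does not occur in this file; nothing here proves a case of the Hodge
conjecture; the row b05 stays OPEN.

André 1996, Prop. 2.2 (p. 16) with Prop. 1.2 (p. 11): `C_mot(X, X)` contains `*_L`, the Lefschetz and Künneth
projectors, and «ces générateurs s'échangent par la transposition» relative to `(x, y) ↦ ⟨x ∪ * y⟩; Prop. 3.3 (p. 21):
the form `(u, v) ↦ Tr(u ∘ *ᵗv*)` on `C⁰_mot(X, X)` is positive definite, whence («résulte aussi du théorème de l'indice
de Hodge, cf. [Kl68] 3.11») the semisimplicity. Parts 1–2 proved the positivity `Tr(T ∘ T') ≥ 0` for `T = [u]_*`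
motivated and `T'` the conjugate `Q_D`-adjoint (`Q_D(T' x, y) = Q_D(x, conj T conj y)`, `Q_D` the polarisation form
of a Kähler–rational datum `D`). THIS FILE shows that `T'` is AGAIN a motivated correspondence operator, for the
complex orientation family and then for every orientation family, in degrees `a ≤ n = dim X`:

  `T' = s ∘ *_η ∘ [σ₊ conj u]_* ∘ *_η ∘ s`, `s = Σ_P (-1)^{i(i-1)/2} π_P` the sign operator of the Lefschetz
  decomposition of `Hᵃ` (MOTIVATED: André Prop. 2.2, the tree's `internalProj_lefschetzSummand_mem_map_corrAction`),
  `*_η` André's Lefschetz involution `Hᵃ ⇄ H^{2n-a}` (MOTIVATED: `lefschetzInvolution_mem_map_corrAction`),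
  `σ₊ conj u` the transpose of the conjugate class (MOTIVATED: `conjClass_mem_motivatedClasses`,
  `complexGysin_braiding_mem_motivatedClasses`; cup-adjunction `cupProduct_corrAction_braiding`),

because `Q_D(x, y) = τ(*_η (s x) ∪ y)` on `Hᵃ`, `a ≤ n` (`cform_eq_cTrace_lefschetzInvolution_signOp`, from the tree's
`LefschetzStandardB.polarizationForm_eq_trace_cup_sum`), `s ∘ s = id`, `*_η ∘ *_η = id`, and the adjoint is unique
(`cform_nondegenerate`).

* §1 the sign operator: `signOp_mem_map_corrAction` (motivated),
  `signOp_signOp` (an involution), **`cform_eq_cTrace_lefschetzInvolution_signOp`** (`Q_D(x, y) = τ(*_η s x ∪ y)`).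
* §2 **`cform_adjoint_conj_mem_map_corrAction_of_le`** — for `u ∈ A_motⁿ(X ⊗ X)_ℂ`, `a ≤ n` and the complex
  orientation family, every conjugate `Q_D`-adjoint `T'` of `[u]_*|_{Hᵃ}` is `[u']_*` for a motivated `u'`;
  `…_of_le_of_orientationFamily` — the same for every orientation family `μ`.
* §3 **`isSemisimpleRing_adjoin_motivatedOperators_of_positiveInvolution`** — ANDRÉ'S OWN PROOF of the semisimplicity
  of `R_a` (`a ≤ n`): a Jacobson-radical element `x` has `x' ∈ R_a` (§2), so `x' x` is nilpotent, `Tr(x ∘ x') =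
  Tr(x' ∘ x) = 0`, and `x = 0` by part 2's positivity — a second proof of gen 37's `isSemisimpleRing_adjoin_motivatedOperators`
  in these degrees, through the positive involution instead of the trace formula.

No definition (the sign operator is written out as a sum), no named fact, no sorry. References: Andre1996Motifs
(Prop. 1.2 p. 11, Prop. 2.2 p. 16, Prop. 3.3 pp. 21–22), Kleiman1968AlgebraicCycles (§1.4 Prop. 1.4.4, §3 3.11),
VoisinHodgeI2002 (§6.2.3 Cor. 6.26, §6.3.2, §7.1.2), Jannsen1992 (Lemma 1–2).
-/

noncomputable section

-- every declaration of this problem lives in `Summit.HodgeConjecture.HodgeConjecture.…` (summit = sub-problem)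
set_option linter.dupNamespace false

open CategoryTheory AlgebraicGeometry MonoidalCategory CartesianMonoidalCategory
open Literature.AlgebraicTopology.SingularHomology Literature.Geometry.Kaehler
open Literature.AlgebraicGeometry Literature.AlgebraicGeometry.Motives
  Literature.AlgebraicGeometry.HodgeTheory
open Summit.HodgeConjecture.HodgeConjecture.Theorems.LefschetzStandardB (conjClass_corrAction
  polarizationForm_eq_trace_cup_sum)

namespace Summit.HodgeConjecture.HodgeConjecture.Theorems

variable {n : ℕ} {X : SchemeOver ℂ}

/-! ## §1 The sign operator of the Lefschetz decomposition and `Q_D(x, y) = τ(*_η s x ∪ y)` -/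

/-- **The sign operator `s = Σ_{P=(i,t)} (-1)^{i(i-1)/2} π_P` of the Lefschetz decomposition of `Hᵃ(X(ℂ); ℂ)` is a
MOTIVATED correspondence operator** (each Lefschetz projector `π_P` is, André Prop. 2.2 — the tree's
`internalProj_lefschetzSummand_mem_map_corrAction`). [cite: Andre1996Motifs, Prop. 2.2 (p. 16)] -/
theorem signOp_mem_map_corrAction (μ : OrientationFamily) (hX : IsSmoothProjective n X) (D : KaehlerRationalDatum n X)
    (a : ℕ) :
    (∑ P : {p : ℕ × ℕ // p.1 + 2 * p.2 = a}, ((-1 : ℂ) ^ (P.1.1 * (P.1.1 - 1) / 2)) •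
        internalProj (isInternal_lefschetzSummand D.Hη n (D.hLℂ hX) (subsingleton_of_lt hX ℂ) a) P) ∈
      (motivatedClasses (n + n) (X ⊗ X) n).map (corrAction μ hX hX (rfl : a + 2 * n = a + 2 * n)) := by
  refine Submodule.sum_mem _ fun P _ ↦ Submodule.smul_mem _ _ ?_
  exact internalProj_lefschetzSummand_mem_map_corrAction μ hX (Ring2.AbelianAll.isPolarizationClass_Hη hX D) a P

/-- **`s ∘ s = id`**: the sign operator is an involution (`π_P π_Q = δ_{PQ} π_P`, `((-1)^k)² = 1`).
[cite: VoisinHodgeI2002, §6.2.3 Cor. 6.26] -/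
theorem signOp_signOp (hX : IsSmoothProjective n X) (D : KaehlerRationalDatum n X) (a : ℕ) (x : complexBetti X a) :
    (∑ P : {p : ℕ × ℕ // p.1 + 2 * p.2 = a}, ((-1 : ℂ) ^ (P.1.1 * (P.1.1 - 1) / 2)) •
        internalProj (isInternal_lefschetzSummand D.Hη n (D.hLℂ hX) (subsingleton_of_lt hX ℂ) a) P)
      ((∑ P : {p : ℕ × ℕ // p.1 + 2 * p.2 = a}, ((-1 : ℂ) ^ (P.1.1 * (P.1.1 - 1) / 2)) •
        internalProj (isInternal_lefschetzSummand D.Hη n (D.hLℂ hX) (subsingleton_of_lt hX ℂ) a) P) x) = x := by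
  classical
  set hI := isInternal_lefschetzSummand D.Hη n (D.hLℂ hX) (subsingleton_of_lt hX ℂ) a
  -- the `P`-component of `s x` is `ε_P • π_P x`
  have hcomp : ∀ P : {p : ℕ × ℕ // p.1 + 2 * p.2 = a},
      internalProj hI P ((∑ Q : {p : ℕ × ℕ // p.1 + 2 * p.2 = a}, ((-1 : ℂ) ^ (Q.1.1 * (Q.1.1 - 1) / 2)) •
        internalProj hI Q) x) = ((-1 : ℂ) ^ (P.1.1 * (P.1.1 - 1) / 2)) • internalProj hI P x := fun P ↦ by
    rw [LinearMap.sum_apply]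
    exact internalProj_eq_of_sum_eq hI (y := fun Q ↦ ((-1 : ℂ) ^ (Q.1.1 * (Q.1.1 - 1) / 2)) • internalProj hI Q x)
      (fun Q ↦ Submodule.smul_mem _ _ (internalProj_mem hI Q x)) rfl P
  conv_rhs => rw [← sum_internalProj hI x]
  rw [LinearMap.sum_apply]
  refine Finset.sum_congr rfl fun P _ ↦ ?_
  rw [LinearMap.smul_apply, hcomp, smul_smul, ← mul_pow, neg_one_mul, neg_neg, one_pow, one_smul]

/-- **`Q_D(x, y) = τ(*_η (s x) ∪ y)` on `Hᵃ(X(ℂ); ℂ)`, `a ≤ n`** (`a + j = n`, `*_η : Hᵃ → H^{a+2j}` André's Lefschetz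
involution, `s` the sign operator): the polarisation form is the cup pairing against `Φ = Σ_P ± L^{n-i-t} ξ_P`
(`LefschetzStandardB.polarizationForm_eq_trace_cup_sum`), and `L^{n-i-t} ξ_P x = Lʲ (Lᵗ ξ_P x) = Lʲ (π_P x) = *_η (π_P x)`
below the middle degree. So the star of `Q_D` is `*_η ∘ s = ± *_L` on each Lefschetz component — the operators of
André's §1.1 Remarque / Prop. 2.2 Cor. 1. [cite: VoisinHodgeI2002, §6.3.2 (6.13) and §7.1.2]
[cite: Andre1996Motifs, §1.1 (pp. 10–11) and Prop. 2.2 Cor. 1 (p. 16)] -/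
theorem cform_eq_cTrace_lefschetzInvolution_signOp (hX : IsSmoothProjective n X) (D : KaehlerRationalDatum n X)
    {a j : ℕ} (hj : a + j = n) (x y : complexBetti X a) :
    D.cform hX a x y = D.cTrace hX (cupProduct (show a + 2 * j + a = 2 * n by omega)
      (lefschetzInvolution (D.hLℂ hX) (show a + (a + 2 * j) = 2 * n by omega)
        ((∑ P : {p : ℕ × ℕ // p.1 + 2 * p.2 = a}, ((-1 : ℂ) ^ (P.1.1 * (P.1.1 - 1) / 2)) •
          internalProj (isInternal_lefschetzSummand D.Hη n (D.hLℂ hX) (subsingleton_of_lt hX ℂ) a) P) x)) y) := by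
  classical
  have hL : HasHardLefschetzProperty D.Hη n := D.hLℂ hX
  have hvan := subsingleton_of_lt hX ℂ
  rw [KaehlerRationalDatum.cform, polarizationForm_eq_trace_cup_sum hL hvan (D.cTrace hX) (show a ≤ n by omega)
    (show a + 2 * j + a = 2 * n by omega) x y]
  refine congrArg (D.cTrace hX) (congrArg (fun w ↦ cupProduct (show a + 2 * j + a = 2 * n by omega) w y) ?_)
  rw [LinearMap.sum_apply, LinearMap.sum_apply, map_sum]
  refine Finset.sum_congr rfl fun P _ ↦ ?_
  have hP := P.2
  rw [LinearMap.smul_apply, LinearMap.smul_apply, map_smul, LinearMap.comp_apply,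
    lefschetzInvolution_apply_of_le hL hj, ← lefschetzPowTo_eq_lefschetzPow,
    ← lefschetzPowTo_primitivePart' hL hvan P x,
    lefschetzPowTo_lefschetzPowTo D.Hη j P.2 rfl (show P.1.1 + 2 * (P.1.2 + j) = a + 2 * j by omega),
    lefschetzPowTo_congr_exponent D.Hη (show n - P.1.1 - P.1.2 = P.1.2 + j by omega)]

/-! ## §2 The conjugate `Q_D`-adjoint of a motivated operator is motivated -/

/-- **ANDRÉ'S INVOLUTION PRESERVES `C⁰_mot(X, X)` — the conjugate `Q_D`-adjoint of a motivated operator is motivated**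
(complex orientation family, degrees `a ≤ n`). For `X` smooth projective of dimension `n`, a Kähler–rational datum
`D`, `a ≤ n`, a motivated `u ∈ A_motⁿ(X ⊗ X)_ℂ` and ANY `T'` with `Q_D(T' x, y) = Q_D(x, conj [u]_* conj y)` on
`Hᵃ(X(ℂ); ℂ)`: `T' = [u']_*` for a motivated `u' ∈ A_motⁿ(X ⊗ X)_ℂ`. Proof: `conj [u]_* conj = [conj u]_*`
(`conjClass_corrAction`); with `v = σ₊ conj u` (motivated), `s` the sign operator and `*₁ : Hᵃ → H^{2n-a}`,
`*₂ : H^{2n-a} → Hᵃ` the Lefschetz involutions (all motivated operators, André Prop. 2.2), the motivated operator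
`S = s ∘ *₂ ∘ [v]_* ∘ *₁ ∘ s` satisfies `Q_D(S x, y) = τ(*₁ s S x ∪ y) = τ([v]_* (*₁ s x) ∪ y) = τ(*₁ s x ∪ [conj u]_* y) =
Q_D(x, [conj u]_* y)` (`s² = id`, `*₁ *₂ = id`, cup-adjunction `cupProduct_corrAction_braiding` — all signs cancel), and
`T' = S` by non-degeneracy of `Q_D`. [cite: Andre1996Motifs, Prop. 2.2 (p. 16) and Prop. 1.2 (p. 11)]
[cite: Kleiman1968AlgebraicCycles, §1.4 Prop. 1.4.4] -/
theorem cform_adjoint_conj_mem_map_corrAction_of_le (hX : IsSmoothProjective n X) (D : KaehlerRationalDatum n X)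
    {a : ℕ} (ha : a ≤ n) {u : complexBetti (X ⊗ X) (2 * n)} (hu : u ∈ motivatedClasses (n + n) (X ⊗ X) n)
    {T' : complexBetti X a →ₗ[ℂ] complexBetti X a}
    (hT' : ∀ x y, D.cform hX a (T' x) y = D.cform hX a x (conjClass (ComplexPoints X) a
      (corrAction complexOrientationFamily hX hX (rfl : a + 2 * n = a + 2 * n) u (conjClass (ComplexPoints X) a y)))) :
    T' ∈ (motivatedClasses (n + n) (X ⊗ X) n).map
      (corrAction complexOrientationFamily hX hX (rfl : a + 2 * n = a + 2 * n)) := by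
  classical
  obtain ⟨j, hj⟩ : ∃ j, a + j = n := ⟨n - a, by omega⟩
  have hXX : IsSmoothProjective (n + n) (X ⊗ X) := hX.tensor_holds hX
  have hη : IsPolarizationClass n X D.Hη := Ring2.AbelianAll.isPolarizationClass_Hη hX D
  have hL : HasHardLefschetzProperty D.Hη n := D.hLℂ hX
  have hab : a + (a + 2 * j) = 2 * n := by omega
  have hba : a + 2 * j + a = 2 * n := by omega
  -- the five motivated operators
  set sOp : complexBetti X a →ₗ[ℂ] complexBetti X a :=
    ∑ P : {p : ℕ × ℕ // p.1 + 2 * p.2 = a}, ((-1 : ℂ) ^ (P.1.1 * (P.1.1 - 1) / 2)) •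
      internalProj (isInternal_lefschetzSummand D.Hη n (D.hLℂ hX) (subsingleton_of_lt hX ℂ) a) P with hsOp
  set star₁ := lefschetzInvolution hL hab with hstar₁
  set star₂ := lefschetzInvolution hL hba with hstar₂
  set ubar := conjClass (ComplexPoints (X ⊗ X)) (2 * n) u with hubar_def
  set v := complexGysin complexOrientationFamily hXX hXX (β_ X X).hom
    (rfl : 2 * n + 2 * (n + n) = 2 * n + 2 * (n + n)) ubar with hv_def
  set V := corrAction complexOrientationFamily hX hX (rfl : a + 2 * j + 2 * n = a + 2 * j + 2 * n) v with hV_def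
  set S := sOp ∘ₗ (star₂ ∘ₗ (V ∘ₗ (star₁ ∘ₗ sOp))) with hS_def
  -- memberships
  have hubar : ubar ∈ motivatedClasses (n + n) (X ⊗ X) n := conjClass_mem_motivatedClasses hXX n hu
  have hv : v ∈ motivatedClasses (n + n) (X ⊗ X) n :=
    complexGysin_braiding_mem_motivatedClasses complexOrientationFamily hX hubar
  have hsMem : sOp ∈ (motivatedClasses (n + n) (X ⊗ X) n).map
      (corrAction complexOrientationFamily hX hX (rfl : a + 2 * n = a + 2 * n)) :=
    signOp_mem_map_corrAction complexOrientationFamily hX D a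
  have hstar₁Mem : star₁ ∈ (motivatedClasses (n + n) (X ⊗ X) (a + 2 * j)).map
      (corrAction complexOrientationFamily hX hX (show a + 2 * (a + 2 * j) = a + 2 * j + 2 * n by omega)) :=
    lefschetzInvolution_mem_map_corrAction complexOrientationFamily hX hη hab
  have hstar₂Mem : star₂ ∈ (motivatedClasses (n + n) (X ⊗ X) a).map
      (corrAction complexOrientationFamily hX hX (show a + 2 * j + 2 * a = a + 2 * n by omega)) :=
    lefschetzInvolution_mem_map_corrAction complexOrientationFamily hX hη hba
  have hVMem : V ∈ (motivatedClasses (n + n) (X ⊗ X) n).map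
      (corrAction complexOrientationFamily hX hX (rfl : a + 2 * j + 2 * n = a + 2 * j + 2 * n)) :=
    Submodule.mem_map_of_mem hv
  have h1 : star₁ ∘ₗ sOp ∈ (motivatedClasses (n + n) (X ⊗ X) (a + 2 * j)).map
      (corrAction complexOrientationFamily hX hX (show a + 2 * (a + 2 * j) = a + 2 * j + 2 * n by omega)) :=
    comp_mem_map_corrAction_motivatedClasses complexOrientationFamily hX hX hX
      (show (a + 2 * j) + n = (a + 2 * j) + n from rfl) rfl (by omega) (by omega) hstar₁Mem hsMem
  have h2 : V ∘ₗ (star₁ ∘ₗ sOp) ∈ (motivatedClasses (n + n) (X ⊗ X) (a + 2 * j)).map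
      (corrAction complexOrientationFamily hX hX (show a + 2 * (a + 2 * j) = a + 2 * j + 2 * n by omega)) :=
    comp_mem_map_corrAction_motivatedClasses complexOrientationFamily hX hX hX
      (show n + (a + 2 * j) = (a + 2 * j) + n by omega) (by omega) rfl (by omega) hVMem h1
  have h3 : star₂ ∘ₗ (V ∘ₗ (star₁ ∘ₗ sOp)) ∈ (motivatedClasses (n + n) (X ⊗ X) n).map
      (corrAction complexOrientationFamily hX hX (rfl : a + 2 * n = a + 2 * n)) :=
    comp_mem_map_corrAction_motivatedClasses complexOrientationFamily hX hX hX
      (show a + (a + 2 * j) = n + n by omega) (by omega) (by omega) rfl hstar₂Mem h2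
  have hS : S ∈ (motivatedClasses (n + n) (X ⊗ X) n).map
      (corrAction complexOrientationFamily hX hX (rfl : a + 2 * n = a + 2 * n)) :=
    comp_mem_map_corrAction_motivatedClasses complexOrientationFamily hX hX hX
      (show n + n = n + n from rfl) rfl rfl rfl hsMem h3
  -- `S` is a conjugate adjoint of `[u]_*`
  have hSadj : ∀ x y, D.cform hX a (S x) y = D.cform hX a x (conjClass (ComplexPoints X) a
      (corrAction complexOrientationFamily hX hX (rfl : a + 2 * n = a + 2 * n) u (conjClass (ComplexPoints X) a y))) := by
    intro x y
    rw [conjClass_corrAction hX hX rfl u, conjClass_conjClass, ← hubar_def,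
      cform_eq_cTrace_lefschetzInvolution_signOp hX D hj, cform_eq_cTrace_lefschetzInvolution_signOp hX D hj]
    -- left: `*₁ s S x = V (*₁ s x)`
    have hleft : star₁ (sOp (S x)) = V (star₁ (sOp x)) := by
      simp only [hS_def, LinearMap.comp_apply]
      rw [signOp_signOp hX D a, hstar₁, hstar₂, lefschetzInvolution_lefschetzInvolution_of_ge hL hj hba hab]
    rw [← hsOp, ← hstar₁, hleft]
    -- right: cup-adjunction, all signs cancel
    set z := star₁ (sOp x) with hz
    rw [cupProduct_gradedComm_holds ℂ (ComplexPoints X) hba hab z,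
      cupProduct_corrAction_braiding complexOrientationFamily hX (rfl : a + 2 * n = a + 2 * n) hab
        (rfl : a + 2 * j + 2 * n = a + 2 * j + 2 * n) hab ubar y z,
      cupProduct_gradedComm_holds ℂ (ComplexPoints X) hab hba y, ← hv_def, ← hV_def, smul_smul, smul_smul,
      ← pow_add, ← pow_add, Even.neg_one_pow ⟨(a + 2 * j) * a + a * (a + 2 * j), by ring⟩, one_smul]
  -- uniqueness of the adjoint
  have hTS : T' = S := by
    refine LinearMap.ext fun x ↦ ?_
    rw [← sub_eq_zero]
    refine (cform_nondegenerate hX D a).1 _ fun y ↦ ?_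
    rw [map_sub, LinearMap.sub_apply, hT', hSadj, sub_self]
  rw [hTS]
  exact hS

/-- **The same for every orientation family `μ`**: the operators `[u]_*^μ` differ from those of the complex
orientation family by one non-zero scalar `c` (`corrAction_eq_smul_of_orientationFamily`), so the image submodules
agree and the conjugate adjoint of `[u]_*^μ = c [u]_*` is `conj c` times that of `[u]_*`.
[cite: Andre1996Motifs, Prop. 2.2 (p. 16)] [cite: FultonYoungTableaux1997, Appendix B §B.1 (5)] -/
theorem cform_adjoint_conj_mem_map_corrAction_of_le_of_orientationFamily (μ : OrientationFamily)
    (hX : IsSmoothProjective n X) (D : KaehlerRationalDatum n X) {a : ℕ} (ha : a ≤ n)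
    {u : complexBetti (X ⊗ X) (2 * n)} (hu : u ∈ motivatedClasses (n + n) (X ⊗ X) n)
    {T' : complexBetti X a →ₗ[ℂ] complexBetti X a}
    (hT' : ∀ x y, D.cform hX a (T' x) y = D.cform hX a x (conjClass (ComplexPoints X) a
      (corrAction μ hX hX (rfl : a + 2 * n = a + 2 * n) u (conjClass (ComplexPoints X) a y)))) :
    T' ∈ (motivatedClasses (n + n) (X ⊗ X) n).map (corrAction μ hX hX (rfl : a + 2 * n = a + 2 * n)) := by
  obtain ⟨c, hc, hμ⟩ := corrAction_eq_smul_of_orientationFamily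
    (OrientationFamily.hasPoincareDuality complexOrientationFamily) (OrientationFamily.hasPoincareDuality μ) hX hX
    (rfl : a + 2 * n = a + 2 * n)
  have hc' : starRingEnd ℂ c ≠ 0 := (map_ne_zero _).2 hc
  rw [hμ, Submodule.map_smul _ _ _ hc]
  -- `(conj c)⁻¹ • T'` is a conjugate adjoint of `[u]_*` for the complex orientation family
  have h := cform_adjoint_conj_mem_map_corrAction_of_le hX D ha hu (T' := (starRingEnd ℂ c)⁻¹ • T') fun x y ↦ by
    rw [LinearMap.smul_apply, map_smul, LinearMap.smul_apply, smul_eq_mul, hT' x y, hμ, LinearMap.smul_apply,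
      LinearMap.smul_apply, conjClass_smul, map_smul, smul_eq_mul, ← mul_assoc, inv_mul_cancel₀ hc', one_mul]
  have h' := Submodule.smul_mem _ (starRingEnd ℂ c) h
  rwa [smul_smul, mul_inv_cancel₀ hc', one_smul] at h'

/-! ## §3 André's own proof of the semisimplicity of `R_a`: a positive involutive algebra is semisimple -/

/-- **SEMISIMPLICITY OF THE MOTIVATED OPERATOR ALGEBRA `R_a` THROUGH THE POSITIVE INVOLUTION** (André 1996, Prop. 3.3,
«résulte aussi du théorème de l'indice de Hodge, cf. [Kl68] 3.11»; degrees `a ≤ n`, any orientation family). `R_a`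
(the subalgebra of `End_ℂ Hᵃ(X(ℂ); ℂ)` generated by — equal to, `adjoin_motivatedOperators_eq` — the operators of
`A_motⁿ(X ⊗ X)_ℂ`) is finite-dimensional, hence Artinian with nilpotent Jacobson radical `J`; for `x ∈ J` the
conjugate adjoint `x'` lies in `R_a` (§2), so `x' x ∈ J` is nilpotent and `Tr(x ∘ x') = Tr(x' ∘ x) = 0`, whence `x = 0`
by the positivity of part 2 (`exists_trace_corrAction_comp_eq_of_mem_motivatedClasses`); `J = 0`. A second proof, in
these degrees, of gen 37's `isSemisimpleRing_adjoin_motivatedOperators` (trace formula + Jannsen).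
[cite: Andre1996Motifs, Prop. 3.3 (pp. 21–22)] [cite: Kleiman1968AlgebraicCycles, §3, 3.11] [cite: Jannsen1992, Lemma 1–2] -/
theorem isSemisimpleRing_adjoin_motivatedOperators_of_positiveInvolution (μ : OrientationFamily)
    (hX : IsSmoothProjective n X) (D : KaehlerRationalDatum n X) {a : ℕ} (ha : a ≤ n) :
    IsSemisimpleRing (Algebra.adjoin ℂ ((motivatedClasses (n + n) (X ⊗ X) n).map
      (corrAction μ hX hX (rfl : a + 2 * n = a + 2 * n)) : Set (Module.End ℂ (complexBetti X a)))) := by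
  set M := (motivatedClasses (n + n) (X ⊗ X) n).map (corrAction μ hX hX (rfl : a + 2 * n = a + 2 * n)) with hM
  set B := Algebra.adjoin ℂ (M : Set (Module.End ℂ (complexBetti X a))) with hB
  have hBM : ∀ x : Module.End ℂ (complexBetti X a), x ∈ B ↔ x ∈ M := fun x ↦ by
    rw [← SetLike.mem_coe, hB, hM, adjoin_motivatedOperators_eq μ hX a, SetLike.mem_coe]
  haveI : Module.Finite ℂ (complexBetti X a) := finite_complexBetti hX a
  haveI : IsArtinianRing B := IsArtinianRing.of_finite ℂ B
  rw [IsArtinianRing.isSemisimpleRing_iff_jacobson]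
  refine eq_bot_iff.mpr fun x hx ↦ ?_
  obtain ⟨k, hk⟩ := IsSemiprimaryRing.isNilpotent (R := B)
  obtain ⟨u, hu, hux⟩ := (hBM x).mp x.2
  -- the conjugate adjoint `x'` of `x = [u]_*` exists and lies in `B`
  obtain ⟨T', hT', -⟩ := exists_unique_cform_adjoint_conj hX D (x : Module.End ℂ (complexBetti X a))
  have hT'u : ∀ z y, D.cform hX a (T' z) y = D.cform hX a z (conjClass (ComplexPoints X) a
      (corrAction μ hX hX (rfl : a + 2 * n = a + 2 * n) u (conjClass (ComplexPoints X) a y))) := by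
    intro z y; rw [hT' z y, ← hux]
  have hT'B : T' ∈ B := (hBM T').2 (cform_adjoint_conj_mem_map_corrAction_of_le_of_orientationFamily μ hX D ha hu hT'u)
  -- `x' x ∈ J` is nilpotent, so `Tr(x x') = Tr(x' x) = 0`
  have hnil : IsNilpotent (T' * (x : Module.End ℂ (complexBetti X a))) := by
    have hmem := Ideal.pow_mem_pow (Ideal.mul_mem_left _ ⟨T', hT'B⟩ hx) k
    rw [hk, Ideal.zero_eq_bot, Ideal.mem_bot] at hmem
    refine ⟨k, ?_⟩
    have h := congrArg Subtype.val hmem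
    simpa only [Subalgebra.coe_pow, Subalgebra.coe_mul, Subalgebra.coe_zero] using h
  have htr : LinearMap.trace ℂ _ (corrAction μ hX hX (rfl : a + 2 * n = a + 2 * n) u ∘ₗ T') = 0 := by
    rw [← Module.End.mul_eq_comp, LinearMap.trace_mul_comm, hux]
    exact (LinearMap.isNilpotent_trace_of_isNilpotent hnil).eq_zero
  -- positivity: `x = 0`
  obtain ⟨r, -, hr, hr0⟩ := exists_trace_corrAction_comp_eq_of_mem_motivatedClasses μ hX D a hu hT'u
  rw [hr, Complex.ofReal_eq_zero] at htr
  have hx0 : (x : Module.End ℂ (complexBetti X a)) = 0 := by rw [← hux]; exact hr0.1 htr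
  rw [Ideal.mem_bot]
  exact Subtype.ext hx0

end Summit.HodgeConjecture.HodgeConjecture.Theorems

end
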